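import Literature.Algebra.Homology.ExtOfProjectiveResolutionNaturality
import HarnessLib

/-!
# Explicit cocycle classes for `Extⁿ(X, Y) ≃+ Hⁿ(Ext⁰(P•, Y))` (the first-variable engine made
# computable: which Yoneda class corresponds to which cocycle)

Topic `Algebra/Homology`; namespace `Literature.Algebra.Homology.LeftResolution`.  Theorems only; no
definition, no named fact, no instance, no `sorry`.  Sequel of
`ExtOfProjectiveResolution` / `ExtOfProjectiveResolutionNaturality` (door-c4 g14).

The engine `extAddEquivHomologySucc/Zero` identifies `Extⁿ(X, Y)` with `Hⁿ(Ext⁰(P•, Y))` through a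
chain of five abstract isomorphisms.  For every later compatibility (connecting homomorphisms, change
of resolution, change of group) one needs to know WHICH class corresponds to WHICH cocycle:

* `homologyIsoSc'_abHomologyIso_inv_mk`: for a cochain complex `K` of abelian groups, the engine's presentation
  `Hʲ(K) ≅ ker dʲ ⧸ Im dʲ⁻¹` sends the coset of `x` to Mathlib's `K.homologyπ j (cyc)` for ANY abstract
  cycle `cyc` with `K.iCycles j cyc = x`;
* `exists_iCycles_eq_comp`: every cocycle of `Ext⁰(P•, Y)` in degree `j` is `p_{Qⱼ} ≫ ē` for a unique
  `ē ∈ Ext⁰(Qⱼ, Y)` (`Qⱼ = coker(Pⱼ₊₁ → Pⱼ)`);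
* **`extAddEquivHomologySucc_symm_homologyπ`**: the class of the cocycle `p_{Qₙ₊₁} ≫ ē` corresponds to
  the Yoneda class `ι⁻¹ ∘ Δₙ([0 → Qₙ₊₁ → Pₙ → Qₙ → 0] ∘ ē) ∈ Extⁿ⁺¹(X, Y)`, where `Δₙ = iterShift` is the
  iterated splicing with the classes of `0 → Qᵢ₊₁ → Pᵢ → Qᵢ → 0` (`i < n`) and `ι : Q₀ ≅ X`;
  **`extAddEquivHomologyZero_symm_homologyπ`**: in degree `0` the class of `p_{Q₀} ≫ ē` is `ι⁻¹ ∘ ē`;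
* `iterShift_comp_one`: the iterated splicing commutes with post-composition by a class of degree `1`
  (`Δₙ(y) ∘ β = Δₙ(y ∘ β)`), the bookkeeping needed for connecting homomorphisms.

Written for Route A of crux `stmt-BirchSwinnertonDyer-19295` (cell `bsd-schneider-ideate`, seat
door-c4 gen 14): the compatibility of `RepExt.extTrivialAddEquivGroupCohomology` with connecting
homomorphisms and with change of group (next files) both start from these formulas.
HONEST FRAMING: homological algebra only.

## References
* C. A. Weibel, *An introduction to homological algebra* (1994), §2.4 (dimension shifting,
  Exercise 2.4.3), Theorem 2.7.6. [Weibel1994]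
-/

noncomputable section

universe w v u

namespace Literature.Algebra.Homology

namespace LeftResolution

open CategoryTheory CategoryTheory.Limits CategoryTheory.Abelian

/-! ## §1 The concrete presentation of the homology of a complex of abelian groups -/

section AbClasses

variable (K : CochainComplex AddCommGrpCat.{w} ℕ)

/-- `iCycles` is injective (a monomorphism of abelian groups). [cite: Weibel1994, §2.4 (Exercise 2.4.3)] -/
theorem iCycles_injective (j : ℕ) : Function.Injective (K.iCycles j).hom :=
  (AddCommGrpCat.mono_iff_injective (K.iCycles j)).1 inferInstance

/-- `homologyπ` is surjective (an epimorphism of abelian groups). [cite: Weibel1994, §2.4 (Exercise 2.4.3)] -/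
theorem homologyπ_surjective (j : ℕ) : Function.Surjective (K.homologyπ j).hom :=
  (AddCommGrpCat.epi_iff_surjective (K.homologyπ j)).1 inferInstance

/-- **The presentation sends the coset of `x ∈ ker dʲ` to the class `homologyπ (cyc)` of any abstract
cycle `cyc` over `x`.** [cite: Weibel1994, §2.4 (Exercise 2.4.3)] -/
theorem homologyIsoSc'_abHomologyIso_inv_mk (i j k : ℕ) (hi : (ComplexShape.up ℕ).prev j = i)
    (hk : (ComplexShape.up ℕ).next j = k) (x : AddMonoidHom.ker (K.sc' i j k).g.hom)
    (cyc : K.cycles j) (hcyc : (K.iCycles j).hom cyc = x.1) :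
    (K.homologyIsoSc' i j k hi hk ≪≫ (K.sc' i j k).abHomologyIso).inv.hom (QuotientAddGroup.mk x) = (K.homologyπ j).hom cyc := by
  have h1 : (K.sc' i j k).abHomologyIso.inv.hom (QuotientAddGroup.mk x) =
      ((K.sc' i j k).homologyπ).hom (((K.sc' i j k).abCyclesIso.inv).hom x) := by
    have h := (K.sc' i j k).abLeftHomologyData.π_comp_homologyIso_inv
    change ((K.sc' i j k).abLeftHomologyData.π ≫ (K.sc' i j k).abLeftHomologyData.homologyIso.inv).hom
      x = ((K.sc' i j k).abLeftHomologyData.cyclesIso.inv ≫ (K.sc' i j k).homologyπ).hom x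
    rw [h]
  change (K.homologyIsoSc' i j k hi hk).inv.hom
    ((K.sc' i j k).abHomologyIso.inv.hom (QuotientAddGroup.mk x)) = _
  rw [h1]
  change ((K.sc' i j k).homologyπ ≫ (K.homologyIsoSc' i j k hi hk).inv).hom _ = _
  rw [K.π_homologyIsoSc'_inv i j k hi hk]
  change (K.homologyπ j).hom ((K.cyclesIsoSc' i j k hi hk).inv.hom
    (((K.sc' i j k).abCyclesIso.inv).hom x)) = (K.homologyπ j).hom cyc
  congr 1
  apply iCycles_injective K j
  change ((K.cyclesIsoSc' i j k hi hk).inv ≫ K.iCycles j).hom _ = _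
  rw [K.cyclesIsoSc'_inv_iCycles i j k hi hk, hcyc]
  exact (K.sc' i j k).abCyclesIso_inv_apply_iCycles x

/-- Every class is the class of a cycle. [cite: Weibel1994, §2.4 (Exercise 2.4.3)] -/
theorem exists_homologyπ_eq (j : ℕ) (w : K.homology j) : ∃ cyc : K.cycles j, (K.homologyπ j).hom cyc = w :=
  homologyπ_surjective K j w

end AbClasses

/-! ## §2 Cocycles of `Ext⁰(P•, Y)` factor through the opcycles -/

section Cocycles

variable {C : Type u} [Category.{v} C] [Abelian C] [HasExt.{w} C] (P : ChainComplex C ℕ) (Y : C)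

/-- **Every cocycle of `Ext⁰(P•, Y)` in degree `j` is `p_{Qⱼ} ≫ ē` for some `ē ∈ Ext⁰(Qⱼ, Y)`**
(`Qⱼ = coker(Pⱼ₊₁ → Pⱼ)`; right exactness of `Hom(–, Y)`). [cite: Weibel1994, §2.4 (Exercise 2.4.3)] -/
theorem exists_iCycles_eq_comp (j : ℕ) (cyc : (homComplex P Y).cycles j) :
    ∃ ē : Ext (P.opcycles j) Y 0,
      ((homComplex P Y).iCycles j).hom cyc = (Ext.mk₀ (P.pOpcycles j)).comp ē (zero_add 0) := by
  have hx : ((homComplex P Y).sc' j j (j + 1)).g.hom (((homComplex P Y).iCycles j).hom cyc) = 0 := by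
    change ((homComplex P Y).iCycles j ≫ (homComplex P Y).d j (j + 1)).hom cyc = 0
    rw [HomologicalComplex.iCycles_d]
    rfl
  refine ⟨(opcyclesExtAddEquiv P Y j j).symm ⟨_, hx⟩, ?_⟩
  rw [← opcyclesExtAddEquiv_apply_val, AddEquiv.apply_symm_apply]

/-- Uniqueness of `ē`. [cite: Weibel1994, §2.4 (Exercise 2.4.3)] -/
theorem comp_pOpcycles_injective (j : ℕ) :
    Function.Injective (fun ē : Ext (P.opcycles j) Y 0 => (Ext.mk₀ (P.pOpcycles j)).comp ē (zero_add 0)) :=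
  Ext.precomp_mk₀_injective_of_epi Y (P.pOpcycles j)

end Cocycles

/-! ## §3 The iterated splicing commutes with post-composition by a degree-one class -/

section IterShift

variable {C : Type u} [Category.{v} C] [Abelian C] [HasExt.{w} C] (P : ChainComplex C ℕ) {Y Y' : C}
  (hP : ∀ n, P.ExactAt (n + 1)) (hY : ∀ n q (e : Ext (P.X n) Y (q + 1)), e = 0)
  (hY' : ∀ n q (e : Ext (P.X n) Y' (q + 1)), e = 0) (β : Ext Y Y' 1)

/-- **`Δₙ(x) ∘ β = Δₙ(x ∘ β)` for a class `β` of degree `1`** (associativity of Yoneda composition,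
iterated). [cite: Weibel1994, §2.4 (Exercise 2.4.3)] -/
theorem iterShift_comp_one :
    ∀ (n : ℕ) {a c d : ℕ} (h : a + 1 + n = c) (hc : c + 1 = d) (h' : a + 1 + 1 + n = d)
      (x : Ext (P.opcycles n) Y (a + 1)),
      (iterShift P Y hP hY n h x).comp β hc =
        iterShift P Y' hP hY' n h' (x.comp β (rfl : a + 1 + 1 = a + 1 + 1))
  | 0, a, c, d, h, hc, h', x => by
    subst h
    subst h'
    rw [iterShift_zero_apply, iterShift_zero_apply]
  | n + 1, a, c, d, h, hc, h', x => by
    rw [iterShift_succ_apply, iterShift_succ_apply,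
      iterShift_comp_one n (a := a + 1) (by omega) hc (by omega), shiftAddEquiv_apply,
      shiftAddEquiv_apply, Ext.comp_assoc _ _ _ (by omega) rfl (by omega)]

end IterShift

/-! ## §4 Which Yoneda class is which cocycle -/

section Classes

variable {C : Type u} [Category.{v} C] [Abelian C] [HasExt.{w} C]
  (P : ChainComplex C ℕ) (Y : C) {X : C} (ε : P.X 0 ⟶ X) (hε : P.d 1 0 ≫ ε = 0)
  (hex : (ShortComplex.mk (P.d 1 0) ε hε).Exact)
  (hP : ∀ n, P.ExactAt (n + 1)) (hY : ∀ n q (e : Ext (P.X n) Y (q + 1)), e = 0)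

/-- The transport `Ext(Q₀, Y) ≃ Ext(X, Y)` undoes `ι⁻¹ ∘ –`. [cite: Weibel1994, §2.4 (Exercise 2.4.3)] -/
theorem extAddEquivOfIsoLeft_symm_inv_comp [Epi ε] (n : ℕ) (z : Ext (P.opcycles 0) Y n) :
    extAddEquivOfIsoLeft (isoOpcyclesZero P ε hε hex).symm Y n
      ((Ext.mk₀ (isoOpcyclesZero P ε hε hex).inv).comp z (zero_add n)) = z := by
  rw [extAddEquivOfIsoLeft_apply, Iso.symm_inv, Ext.mk₀_comp_mk₀_assoc, Iso.hom_inv_id,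
    Ext.mk₀_id_comp]

omit [HasExt C] in
/-- `extOneQuotientAddEquiv ([S] ∘ x) = [x]`. [cite: Weibel1994, §2.4 (Exercise 2.4.3)] -/
theorem extOneQuotientAddEquiv_apply_extClass_comp [HasExt.{w} C] {S : ShortComplex C}
    (hS : S.ShortExact) (h1 : ∀ e : Ext S.X₂ Y 1, e = 0) (x : Ext S.X₁ Y 0) :
    extOneQuotientAddEquiv Y hS h1 (hS.extClass.comp x (add_zero 1)) = QuotientAddGroup.mk x := by
  apply (extOneQuotientAddEquiv Y hS h1).symm.injective
  rw [AddEquiv.symm_apply_apply, extOneQuotientAddEquiv_symm_mk]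

/-- **Positive degrees, presentation form**: `E(ι⁻¹ ∘ Δₙ([Sₙ] ∘ ē))` is the coset of the cocycle
`p_{Qₙ₊₁} ≫ ē`. [cite: Weibel1994, §2.4 (Exercise 2.4.3), Theorem 2.7.6] -/
theorem extAddEquivHomologySucc_apply_class [Epi ε] (n : ℕ) (ē : Ext (P.opcycles (n + 1)) Y 0) :
    extAddEquivHomologySucc P Y ε hε hex hP hY n
        ((Ext.mk₀ (isoOpcyclesZero P ε hε hex).inv).comp
          (iterShift P Y hP hY n (a := 0) (b := n + 1) (by omega)
            ((opcyclesSC_shortExact P n (hP n)).extClass.comp ē (add_zero 1))) (zero_add (n + 1))) =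
      ((homComplex P Y).homologyIsoSc' n (n + 1) (n + 1 + 1) (CochainComplex.prev_nat_succ n)
          (CochainComplex.next ℕ (n + 1)) ≪≫ ShortComplex.abHomologyIso _).inv.hom
        (QuotientAddGroup.mk (opcyclesExtAddEquiv P Y n (n + 1) ē)) := by
  change (((homComplex P Y).homologyIsoSc' n (n + 1) (n + 1 + 1) (CochainComplex.prev_nat_succ n)
      (CochainComplex.next ℕ (n + 1)) ≪≫ ShortComplex.abHomologyIso _).addCommGroupIsoToAddEquiv.symm
    (QuotientAddGroup.congr _ _ (opcyclesExtAddEquiv P Y n (n + 1))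
      (map_opcyclesExtAddEquiv_range P Y n)
      (extOneQuotientAddEquiv Y (opcyclesSC_shortExact P n (hP n)) (hY n 0)
        ((iterShift P Y hP hY n (a := 0) (b := n + 1) (by omega)).symm
          (extAddEquivOfIsoLeft (isoOpcyclesZero P ε hε hex).symm Y (n + 1)
            ((Ext.mk₀ (isoOpcyclesZero P ε hε hex).inv).comp
              (iterShift P Y hP hY n (a := 0) (b := n + 1) (by omega)
                ((opcyclesSC_shortExact P n (hP n)).extClass.comp ē (add_zero 1)))
              (zero_add (n + 1)))))))) = _
  rw [extAddEquivOfIsoLeft_symm_inv_comp, AddEquiv.symm_apply_apply,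
    extOneQuotientAddEquiv_apply_extClass_comp]
  rfl

/-- **Degree `0`, presentation form**: `E(ι⁻¹ ∘ ē)` is the coset of the cocycle `p_{Q₀} ≫ ē`.
[cite: Weibel1994, §2.4 (Exercise 2.4.3), Theorem 2.7.6] -/
theorem extAddEquivHomologyZero_apply_class [Epi ε] (ē : Ext (P.opcycles 0) Y 0) :
    extAddEquivHomologyZero P Y ε hε hex
        ((Ext.mk₀ (isoOpcyclesZero P ε hε hex).inv).comp ē (zero_add 0)) =
      ((homComplex P Y).homologyIsoSc' 0 0 1 CochainComplex.prev_nat_zero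
          (CochainComplex.next ℕ 0) ≪≫ ShortComplex.abHomologyIso _).inv.hom
        (QuotientAddGroup.mk (opcyclesExtAddEquiv P Y 0 0 ē)) := by
  change (((homComplex P Y).homologyIsoSc' 0 0 1 CochainComplex.prev_nat_zero
      (CochainComplex.next ℕ 0) ≪≫ ShortComplex.abHomologyIso _).addCommGroupIsoToAddEquiv.symm
    (QuotientAddGroup.quotientAddEquivOfEq (abToCycles_zero_range_eq_bot P Y).symm
      (QuotientAddGroup.quotientBot.symm
        (opcyclesExtAddEquiv P Y 0 0
          (extAddEquivOfIsoLeft (isoOpcyclesZero P ε hε hex).symm Y 0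
            ((Ext.mk₀ (isoOpcyclesZero P ε hε hex).inv).comp ē (zero_add 0))))))) = _
  rw [extAddEquivOfIsoLeft_symm_inv_comp]
  rfl

/-- **Positive degrees: the Yoneda class of the cocycle `p_{Qₙ₊₁} ≫ ē` is `ι⁻¹ ∘ Δₙ([Sₙ] ∘ ē)`** —
for every abstract cycle `cyc` of `Ext⁰(P•, Y)` in degree `n + 1` lying over `p_{Qₙ₊₁} ≫ ē`,
`E⁻¹(homologyπ cyc) = ι⁻¹ ∘ iterShift n ([0 → Qₙ₊₁ → Pₙ → Qₙ → 0] ∘ ē)`.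
[cite: Weibel1994, §2.4 (Exercise 2.4.3), Theorem 2.7.6] -/
theorem extAddEquivHomologySucc_symm_homologyπ [Epi ε] (n : ℕ) (ē : Ext (P.opcycles (n + 1)) Y 0)
    (cyc : (homComplex P Y).cycles (n + 1))
    (hcyc : ((homComplex P Y).iCycles (n + 1)).hom cyc = (Ext.mk₀ (P.pOpcycles (n + 1))).comp ē (zero_add 0)) :
    (extAddEquivHomologySucc P Y ε hε hex hP hY n).symm (((homComplex P Y).homologyπ (n + 1)).hom cyc) =
      (Ext.mk₀ (isoOpcyclesZero P ε hε hex).inv).comp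
        (iterShift P Y hP hY n (a := 0) (b := n + 1) (by omega)
          ((opcyclesSC_shortExact P n (hP n)).extClass.comp ē (add_zero 1))) (zero_add (n + 1)) := by
  apply (extAddEquivHomologySucc P Y ε hε hex hP hY n).injective
  rw [AddEquiv.apply_symm_apply, extAddEquivHomologySucc_apply_class,
    homologyIsoSc'_abHomologyIso_inv_mk (homComplex P Y) n (n + 1) (n + 1 + 1) _ _ _ cyc
      (by rw [opcyclesExtAddEquiv_apply_val, hcyc])]

/-- **Degree `0`: the Yoneda class of the cocycle `p_{Q₀} ≫ ē` is `ι⁻¹ ∘ ē`.**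
[cite: Weibel1994, §2.4 (Exercise 2.4.3), Theorem 2.7.6] -/
theorem extAddEquivHomologyZero_symm_homologyπ [Epi ε] (ē : Ext (P.opcycles 0) Y 0)
    (cyc : (homComplex P Y).cycles 0)
    (hcyc : ((homComplex P Y).iCycles 0).hom cyc = (Ext.mk₀ (P.pOpcycles 0)).comp ē (zero_add 0)) :
    (extAddEquivHomologyZero P Y ε hε hex).symm (((homComplex P Y).homologyπ 0).hom cyc) =
      (Ext.mk₀ (isoOpcyclesZero P ε hε hex).inv).comp ē (zero_add 0) := by
  apply (extAddEquivHomologyZero P Y ε hε hex).injective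
  rw [AddEquiv.apply_symm_apply, extAddEquivHomologyZero_apply_class,
    homologyIsoSc'_abHomologyIso_inv_mk (homComplex P Y) 0 0 1 _ _ _ cyc
      (by rw [opcyclesExtAddEquiv_apply_val, hcyc])]

/-- **Every class of `Extⁿ⁺¹(X, Y)` is `ι⁻¹ ∘ Δₙ([Sₙ] ∘ ē)` for some `ē ∈ Ext⁰(Qₙ₊₁, Y)`** (the
engine is onto). [cite: Weibel1994, §2.4 (Exercise 2.4.3), Theorem 2.7.6] -/
theorem exists_eq_inv_comp_iterShift [Epi ε] (n : ℕ) (x : Ext X Y (n + 1)) :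
    ∃ ē : Ext (P.opcycles (n + 1)) Y 0,
      x = (Ext.mk₀ (isoOpcyclesZero P ε hε hex).inv).comp
        (iterShift P Y hP hY n (a := 0) (b := n + 1) (by omega)
          ((opcyclesSC_shortExact P n (hP n)).extClass.comp ē (add_zero 1))) (zero_add (n + 1)) := by
  obtain ⟨cyc, hcyc⟩ := exists_homologyπ_eq (homComplex P Y) (n + 1)
    (extAddEquivHomologySucc P Y ε hε hex hP hY n x)
  obtain ⟨ē, hē⟩ := exists_iCycles_eq_comp P Y (n + 1) cyc
  refine ⟨ē, ?_⟩
  rw [← extAddEquivHomologySucc_symm_homologyπ P Y ε hε hex hP hY n ē cyc hē, hcyc,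
    AddEquiv.symm_apply_apply]

/-- Degree `0`: every class of `Ext⁰(X, Y)` is `ι⁻¹ ∘ ē`. [cite: Weibel1994, §2.4 (Exercise 2.4.3), Theorem 2.7.6] -/
theorem exists_eq_inv_comp_zero [Epi ε] (x : Ext X Y 0) :
    ∃ ē : Ext (P.opcycles 0) Y 0,
      x = (Ext.mk₀ (isoOpcyclesZero P ε hε hex).inv).comp ē (zero_add 0) := by
  obtain ⟨cyc, hcyc⟩ := exists_homologyπ_eq (homComplex P Y) 0 (extAddEquivHomologyZero P Y ε hε hex x)
  obtain ⟨ē, hē⟩ := exists_iCycles_eq_comp P Y 0 cyc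
  refine ⟨ē, ?_⟩
  rw [← extAddEquivHomologyZero_symm_homologyπ P Y ε hε hex ē cyc hē, hcyc, AddEquiv.symm_apply_apply]

end Classes

end LeftResolution

end Literature.Algebra.Homology
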